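import Literature.AlgebraicGeometry.Frobenioids.BirationalNormalizationExampleMorphisms
import HarnessLib

/-!
# Frobenioids I, Example 4.6: `C` is a Frobenioid — part 2, clauses (i)–(iii) of Definition 1.3

Mochizuki, *The geometry of Frobenioids I: the general theory*, Kyushu J. Math. **62** (2008)
293–400, kurims text pp. 86–87 ("one checks immediately that, relative to this last functor, `C` is a
Frobenioid") with Def. 1.3 pp. 24–25 [cite: MochizukiFrdI2008, Ex. 4.6 p.87]. PROOF-ONLY; continues
`BirationalNormalizationExampleMorphisms.lean` (the Def. 1.2 dictionary of `C → F_Φ`). Contents: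

* `O^▷(A_n) = {(h, 0, 0, 1)} ≅ G` (`exists_endEquiv`: "for every `A ∈ Ob(C)`, `O^▷(A) = G`", p. 87) and
  "`A₀` is Frobenius-trivial" (`isFrobeniusTrivial_A₀`, p. 87, via `ζ(d) = (0, 0, 0, d)`);
* Def. 1.3 (i)(a)(b)(c), (ii), (iii)(a)–(d) for `C → F_Φ`: Frobenius-type arrows of degree `d` out of `A_n`
  are the `(g, 0, 0, d) : A_n → A_{dn}`; pull-backs are isomorphisms so `C^pl-bk_A ≃ D_{A_D} = pt`; along a
  pre-step `(g, a, b, 1)` the bijection `O^▷(A) ⥲ O^▷(B)` is the identity of `G` (as `Ξ(1) = 0`); the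
  coslice/slice categories of co-angular pre-steps are `Order(ℤ_{≥0}²)` via `Div`.
Part 3 (`…IsFrobenioid.lean`) does (iv)–(vii) and assembles `Ex46.isFrobenioid`.
No statement of the paper is strengthened; nothing here takes a side on [IUTchIII] Cor. 3.12.
-/

namespace Literature.AlgebraicGeometry.Frobenioids

open CategoryTheory Opposite

namespace Ex46

open PreFrobenioid

variable {G : Type} [AddCommGroup G] (P : Datum G)

/-! ### `O^▷(A) ≅ G` and the Frobenius-trivial object `A₀` -/

/-- `α ∈ O^▷(A)` iff `d(α) = 1` (base-identity is automatic). [cite: MochizukiFrdI2008, Ex. 4.6 p.87] -/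
theorem mem_endSubmonoid_iff {X : Obj P} (α : End X) : α ∈ endSubmonoid (toElem P) X ↔ (val P α).d = 1 :=
  ⟨fun h => h.2, fun h => ⟨isBaseIdentity P α, h⟩⟩

/-- An element of `O^▷(A_n)` is `(h, 0, 0, 1)` (`n − n = a + b` forces `a = b = 0`). [cite: MochizukiFrdI2008, Ex. 4.6 p.87] -/
theorem coords_of_mem_endSubmonoid {X : Obj P} {α : End X} (h : α ∈ endSubmonoid (toElem P) X) :
    (val P α).d = 1 ∧ (val P α).a = 0 ∧ (val P α).b = 0 := by
  have hd : (val P α).d = 1 := h.2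
  have hi := idx_eq P α
  rw [hd, PNat.one_coe, Nat.cast_one, one_mul, sub_self] at hi
  have ha := a_nonneg P α
  have hb := b_nonneg P α
  exact ⟨hd, by linarith, by linarith⟩

/-- Hence `val α = ((g(α), 0, 0), 1)` for `α ∈ O^▷(A)`. [cite: MochizukiFrdI2008, Ex. 4.6 p.87] -/
theorem val_eq_of_mem_endSubmonoid {X : Obj P} {α : End X} (h : α ∈ endSubmonoid (toElem P) X) :
    val P α = ⟨((val P α).μ.1, 0, 0), 1⟩ := by
  obtain ⟨hd, ha, hb⟩ := coords_of_mem_endSubmonoid P h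
  exact N.ext (Prod.ext rfl (Prod.ext ha hb)) hd

/-- The `g`-coordinate is additive on `O^▷(A)`: `g(α α') = g(α) + g(α')` (`Ξ(1) = 0`). [cite: MochizukiFrdI2008, Ex. 4.6 p.87] -/
theorem g_mul_of_mem {X : Obj P} {α β : End X} (hα : α ∈ endSubmonoid (toElem P) X)
    (hβ : β ∈ endSubmonoid (toElem P) X) : (val P (α * β)).μ.1 = (val P α).μ.1 + (val P β).μ.1 := by
  obtain ⟨hd, -, -⟩ := coords_of_mem_endSubmonoid P hα
  obtain ⟨-, ha, -⟩ := coords_of_mem_endSubmonoid P hβ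
  show (val P (β ≫ α)).μ.1 = _
  rw [comp_g, hd, ha, PNat.one_coe, Nat.cast_one, one_smul, zero_smul, add_zero]

/-- **"for every `A ∈ Ob(C)`, `O^▷(A) = G`"** (FrdI p. 87): `α ↦ g(α)` is an isomorphism `O^▷(A_n) ⥲ G`
(inverse `h ↦ (h, 0, 0, 1)`). [cite: MochizukiFrdI2008, Ex. 4.6 p.87] -/
theorem exists_endEquiv (X : Obj P) :
    ∃ e : endSubmonoid (toElem P) X ≃* Multiplicative G, ∀ α, e α = Multiplicative.ofAdd (val P α.1).μ.1 := by
  have hX : X.idx - (((1 : ℕ+) : ℕ) : ℤ) * X.idx = 0 + 0 := by simp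
  let mk : G → (X ⟶ X) := fun h => ⟨⟨(h, 0, 0), 1⟩, le_rfl, le_rfl, hX⟩
  have hmk : ∀ h, mk h ∈ endSubmonoid (toElem P) X := fun h => (mem_endSubmonoid_iff P _).mpr rfl
  refine ⟨{ toFun := fun α => Multiplicative.ofAdd (val P α.1).μ.1
            invFun := fun x => ⟨mk (Multiplicative.toAdd x), hmk _⟩
            left_inv := fun α => Subtype.ext (hom_ext P ((val_eq_of_mem_endSubmonoid P α.2).symm ▸ rfl))
            right_inv := fun x => by simp [mk]
            map_mul' := fun α β => by
              rw [← ofAdd_add]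
              exact congrArg Multiplicative.ofAdd (g_mul_of_mem P α.2 β.2) }, fun α => rfl⟩

/-- **"the object `A₀ ∈ Ob(C)` is Frobenius-trivial"** (FrdI p. 87): `ζ(d) = (0, 0, 0, d) ∈ End(A₀)` is a
homomorphism `N_{≥1} → End(A₀)` splitting `deg_Fr` with base-identity values of Frobenius type.
[cite: MochizukiFrdI2008, Ex. 4.6 p.87] -/
theorem isFrobeniusTrivial_A₀ : IsFrobeniusTrivial (toElem P) (A₀ P) := by
  have h0 : ∀ d : ℕ+, (A₀ P).idx - (d : ℤ) * (A₀ P).idx = 0 + 0 := fun d => by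
    show (0 : ℤ) - (d : ℤ) * 0 = 0 + 0; ring
  let ζ : ℕ+ → End (A₀ P) := fun d => ⟨⟨(0, 0, 0), d⟩, le_rfl, le_rfl, h0 d⟩
  refine ⟨{ toFun := ζ
            map_one' := hom_ext P rfl
            map_mul' := fun m n => hom_ext P ?_ }, fun n => ⟨rfl, isBaseIdentity P _, ?_⟩⟩
  · rw [End.mul_def, val_comp]
    refine N.ext ?_ rfl
    rw [N.mul_μ]
    show (0 : Mmod G) = (0 : Mmod G) + P.α m (0 : Mmod G)
    rw [map_zero, add_zero]
  · exact (isFrobeniusType_iff P _).mpr ⟨rfl, rfl⟩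

/-! ### Definition 1.3 (i) -/

/-- (i)(a): `A₀` is a Frobenius-trivial object over the unique object of `D`. [cite: MochizukiFrdI2008, Def. 1.3(i) p.24] -/
theorem i_a (X : Discrete PUnit.{1}) :
    ∃ A : Obj P, IsFrobeniusTrivial (toElem P) A ∧ Nonempty (baseObj (toElem P) A ≅ X) :=
  ⟨A₀ P, isFrobeniusTrivial_A₀ P, ⟨eqToIso (by cases X; rfl)⟩⟩

/-- (i)(b): over the one-morphism base, any two objects `A_n`, `A_m` receive pre-steps from `A_{min(n,m)}`.
[cite: MochizukiFrdI2008, Def. 1.3(i) p.24] -/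
theorem i_b (A B : Obj P) (α : baseObj (toElem P) A ≅ baseObj (toElem P) B) :
    ∃ (Y : Obj P) (φ : Y ⟶ A) (ψ : Y ⟶ B), IsPreStep (toElem P) φ ∧ IsPreStep (toElem P) ψ ∧
      Base (toElem P) φ ≫ α.hom = Base (toElem P) ψ := by
  let Y : Obj P := ⟨min A.idx B.idx⟩
  obtain ⟨φ, hφ⟩ := exists_hom P Y A 0 (A.idx - min A.idx B.idx) 0 1 (by simp) le_rfl (by simp [Y])
  obtain ⟨ψ, hψ⟩ := exists_hom P Y B 0 (B.idx - min A.idx B.idx) 0 1 (by simp) le_rfl (by simp [Y])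
  exact ⟨Y, φ, ψ, (isPreStep_iff P φ).mpr (by rw [hφ]), (isPreStep_iff P ψ).mpr (by rw [hψ]),
    Subsingleton.elim _ _⟩

/-- (i)(c): `C^pl-bk_A → D_{A_D}` is an equivalence (pull-backs are the isomorphisms, `D_{A_D}` is a point).
[cite: MochizukiFrdI2008, Def. 1.3(i) p.24] -/
theorem i_c (A : Obj P) : (pullbackSliceToBase (toElem P) A).IsEquivalence := by
  haveI := pullbackSliceToBase_faithful (toElem P) A
  haveI := pullbackSliceToBase_full (toElem P) A
  haveI : (pullbackSliceToBase (toElem P) A).EssSurj := by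
    refine ⟨fun Y => ⟨Over.mk (𝟙 (⟨A⟩ : PullbackCat (toElem P))), ⟨Over.isoMk (eqToIso ?_) ?_⟩⟩⟩
    · cases Y.left; rfl
    · exact Subsingleton.elim _ _
  exact {}

/-! ### Definition 1.3 (ii) -/

/-- (ii), existence: `(0, 0, 0, d) : A_n → A_{dn}` is of Frobenius type of degree `d`.
[cite: MochizukiFrdI2008, Def. 1.3(ii) p.24] -/
theorem ii_exists (A : Obj P) (d : ℕ+) :
    ∃ (B : Obj P) (φ : A ⟶ B), IsFrobeniusType (toElem P) φ ∧ degFr (toElem P) φ = d := by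
  obtain ⟨φ, hφ⟩ := exists_hom P A ⟨(d : ℤ) * A.idx⟩ 0 0 0 d le_rfl le_rfl (by simp)
  exact ⟨_, φ, (isFrobeniusType_iff P φ).mpr (by rw [hφ]; exact ⟨rfl, rfl⟩), by rw [degFr_eq, hφ]⟩

/-- (ii), essential uniqueness: two Frobenius-type arrows of degree `d` out of `A_n` land in `A_{dn}` and
differ by the automorphism `(g' − g, 0, 0, 1)`. [cite: MochizukiFrdI2008, Def. 1.3(ii) p.24] -/
theorem ii_unique {A B B' : Obj P} (φ : A ⟶ B) (ψ : A ⟶ B') (hφ : IsFrobeniusType (toElem P) φ)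
    (hψ : IsFrobeniusType (toElem P) ψ) (hd : degFr (toElem P) φ = degFr (toElem P) ψ) :
    ∃ β : B ≅ B', φ ≫ β.hom = ψ := by
  obtain ⟨ha, hb⟩ := (isFrobeniusType_iff P φ).mp hφ
  obtain ⟨ha', hb'⟩ := (isFrobeniusType_iff P ψ).mp hψ
  have hd' : (val P φ).d = (val P ψ).d := hd
  have hiφ := idx_eq P φ
  have hiψ := idx_eq P ψ
  rw [ha, hb] at hiφ
  rw [ha', hb', ← hd'] at hiψ
  obtain ⟨β, hβ⟩ := exists_hom P B B' ((val P ψ).μ.1 - (val P φ).μ.1) 0 0 1 le_rfl le_rfl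
    (by rw [PNat.one_coe, Nat.cast_one, one_mul]; linarith)
  haveI : IsIso β := (isIso_iff P β).mpr (by rw [hβ]; exact ⟨rfl, rfl, rfl⟩)
  refine ⟨asIso β, hom_ext P (N.ext (Prod.ext ?_ (Prod.ext ?_ ?_)) ?_)⟩
  · rw [asIso_hom, comp_g, hβ, ha, zero_smul, add_zero, PNat.one_coe, Nat.cast_one, one_smul]
    show (val P ψ).μ.1 - (val P φ).μ.1 + (val P φ).μ.1 = (val P ψ).μ.1
    abel
  · show (val P (φ ≫ β)).a = (val P ψ).a
    rw [comp_a, hβ, ha, ha', mul_zero, add_zero]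
  · show (val P (φ ≫ β)).b = (val P ψ).b
    rw [comp_b, hβ, hb, hb', mul_zero, add_zero]
  · rw [asIso_hom, comp_d, hβ, hd']
    exact one_mul _

/-! ### Definition 1.3 (iii) -/

/-- (iii)(a): co-angular arrows compose (all arrows are co-angular). [cite: MochizukiFrdI2008, Def. 1.3(iii) p.24] -/
theorem iii_a {A B B' : Obj P} (f : A ⟶ B) (g : B ⟶ B') (_hf : IsCoAngular (toElem P) f)
    (_hg : IsCoAngular (toElem P) g) : IsCoAngular (toElem P) (f ≫ g) :=
  isCoAngular P _

/-- (iii)(b): all arrows are co-angular. [cite: MochizukiFrdI2008, Def. 1.3(iii) p.24] -/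
theorem iii_b {A' A : Obj P} (φ : A' ⟶ A) (_hφ : IsCoAngularPreStep (toElem P) φ) (ψ : A' ⟶ A) :
    IsCoAngular (toElem P) ψ :=
  isCoAngular P ψ

/-- (iii)(c): along a co-angular pre-step `φ = (g, a, b, 1) : A → B` the composite `O^▷(A) ≅ G ≅ O^▷(B)`
intertwines: `(h,0,0,1) ∘ φ = φ ∘ (h,0,0,1)` since `Ξ(1) = 0`. [cite: MochizukiFrdI2008, Def. 1.3(iii) p.24] -/
theorem iii_c {A B : Obj P} (φ : A ⟶ B) (hφ : IsCoAngularPreStep (toElem P) φ) :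
    ∃ e : endSubmonoid (toElem P) A ≃* endSubmonoid (toElem P) B,
      ∀ α : endSubmonoid (toElem P) A, φ ≫ (show B ⟶ B from (e α).1) = (show A ⟶ A from α.1) ≫ φ := by
  have hd : (val P φ).d = 1 := (isCoAngularPreStep_iff P φ).mp hφ
  obtain ⟨eA, heA⟩ := exists_endEquiv P A
  obtain ⟨eB, heB⟩ := exists_endEquiv P B
  refine ⟨eA.trans eB.symm, fun α => ?_⟩
  have h1 : eB ((eA.trans eB.symm) α) = Multiplicative.ofAdd (val P α.1).μ.1 := by
    rw [MulEquiv.trans_apply, MulEquiv.apply_symm_apply, heA]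
  have hgB : (val P ((eA.trans eB.symm) α).1).μ.1 = (val P α.1).μ.1 :=
    Multiplicative.ofAdd.injective ((heB _).symm.trans h1)
  have hB := val_eq_of_mem_endSubmonoid P ((eA.trans eB.symm) α).2
  have hA := val_eq_of_mem_endSubmonoid P α.2
  rw [hgB] at hB
  apply hom_ext P
  rw [val_comp, val_comp, hB, hA]
  refine N.ext ?_ ?_
  · simp only [N.mul_μ, hd, Datum.α_one, AddMonoidHom.id_apply]
    exact add_comm _ _
  · rw [N.mul_d, N.mul_d, hd]

/-- (iii)(c), dependence on `Base(φ)` only: the intertwined element has the same `g`-coordinate.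
[cite: MochizukiFrdI2008, Def. 1.3(iii) p.24] -/
theorem iii_c_base {A B : Obj P} (φ φ' : A ⟶ B) (hφ : IsCoAngularPreStep (toElem P) φ)
    (hφ' : IsCoAngularPreStep (toElem P) φ') (_hb : Base (toElem P) φ = Base (toElem P) φ')
    (α : endSubmonoid (toElem P) A) (β β' : endSubmonoid (toElem P) B)
    (h : φ ≫ (show B ⟶ B from β.1) = (show A ⟶ A from α.1) ≫ φ)
    (h' : φ' ≫ (show B ⟶ B from β'.1) = (show A ⟶ A from α.1) ≫ φ') : β = β' := by
  have hd : (val P φ).d = 1 := (isCoAngularPreStep_iff P φ).mp hφ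
  have hd' : (val P φ').d = 1 := (isCoAngularPreStep_iff P φ').mp hφ'
  obtain ⟨hαd, hαa, -⟩ := coords_of_mem_endSubmonoid P α.2
  obtain ⟨hβd, -, -⟩ := coords_of_mem_endSubmonoid P β.2
  obtain ⟨hβd', -, -⟩ := coords_of_mem_endSubmonoid P β'.2
  have key : ∀ {ψ : A ⟶ B} {γ : endSubmonoid (toElem P) B}, (val P ψ).d = 1 → (val P γ.1).d = 1 →
      ψ ≫ (show B ⟶ B from γ.1) = (show A ⟶ A from α.1) ≫ ψ → (val P γ.1).μ.1 = (val P α.1).μ.1 := by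
    intro ψ γ hψ hγ e
    have e1 := congrArg (fun f : A ⟶ B => (val P f).μ.1) e
    simp only [comp_g, hψ, hγ, hαa, PNat.one_coe, Nat.cast_one, one_smul, add_zero,
      Datum.Ξ_one, smul_zero] at e1
    -- `e1 : g(γ) + g(ψ) = g(ψ) + g(α)`
    have := e1
    rw [add_comm] at this
    exact add_left_cancel this
  have e1 := key hd hβd h
  have e2 := key hd' hβd' h'
  refine Subtype.ext (hom_ext P ?_)
  rw [val_eq_of_mem_endSubmonoid P β.2, val_eq_of_mem_endSubmonoid P β'.2, e1, e2]

/-- `Div φ ∣ Div φ'` in `ℤ_{≥0}²` means `a ≤ a'` and `b ≤ b'`. [cite: MochizukiFrdI2008, Def. 1.3(iii) p.24] -/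
theorem le_of_div_dvd {A B A' B' : Obj P} {φ : A ⟶ B} {φ' : A' ⟶ B'}
    (h : Multiplicative.ofAdd (((val P φ).a.toNat, (val P φ).b.toNat) : ℕ × ℕ) ∣
      Multiplicative.ofAdd (((val P φ').a.toNat, (val P φ').b.toNat) : ℕ × ℕ)) :
    (val P φ).a ≤ (val P φ').a ∧ (val P φ).b ≤ (val P φ').b := by
  obtain ⟨c, hc⟩ := h
  have hc' := congrArg Multiplicative.toAdd hc
  rw [toAdd_ofAdd, toAdd_mul, toAdd_ofAdd] at hc'
  have h1 : (val P φ).a.toNat ≤ (val P φ').a.toNat := by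
    have := congrArg Prod.fst hc'; simp only [Prod.fst_add] at this; omega
  have h2 : (val P φ).b.toNat ≤ (val P φ').b.toNat := by
    have := congrArg Prod.snd hc'; simp only [Prod.snd_add] at this; omega
  have ea := Int.toNat_of_nonneg (a_nonneg P φ)
  have ea' := Int.toNat_of_nonneg (a_nonneg P φ')
  have eb := Int.toNat_of_nonneg (b_nonneg P φ)
  have eb' := Int.toNat_of_nonneg (b_nonneg P φ')
  constructor
  · calc (val P φ).a = ((val P φ).a.toNat : ℤ) := ea.symm
      _ ≤ ((val P φ').a.toNat : ℤ) := by exact_mod_cast h1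
      _ = (val P φ').a := ea'
  · calc (val P φ).b = ((val P φ).b.toNat : ℤ) := eb.symm
      _ ≤ ((val P φ').b.toNat : ℤ) := by exact_mod_cast h2
      _ = (val P φ').b := eb'

/-- (iii)(d), coslice, fullness: `Div φ ≤ Div φ'` lifts to `(g' − g, a' − a, b' − b, 1) : B → B'` under `A`.
[cite: MochizukiFrdI2008, Def. 1.3(iii) p.24] -/
theorem iii_d_under_full {A B B' : Obj P} (φ : A ⟶ B) (φ' : A ⟶ B') (hφ : IsCoAngularPreStep (toElem P) φ)
    (hφ' : IsCoAngularPreStep (toElem P) φ') (hdiv : Div (toElem P) φ ∣ Div (toElem P) φ') :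
    ∃ f : B ⟶ B', IsCoAngularPreStep (toElem P) f ∧ φ ≫ f = φ' := by
  have hd : (val P φ).d = 1 := (isCoAngularPreStep_iff P φ).mp hφ
  have hd' : (val P φ').d = 1 := (isCoAngularPreStep_iff P φ').mp hφ'
  obtain ⟨ha, hb⟩ := le_of_div_dvd P hdiv
  have hi := idx_eq P φ
  have hi' := idx_eq P φ'
  rw [hd, PNat.one_coe, Nat.cast_one, one_mul] at hi
  rw [hd', PNat.one_coe, Nat.cast_one, one_mul] at hi'
  obtain ⟨f, hf⟩ := exists_hom P B B' ((val P φ').μ.1 - (val P φ).μ.1) ((val P φ').a - (val P φ).a)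
    ((val P φ').b - (val P φ).b) 1 (by linarith) (by linarith) (by rw [PNat.one_coe, Nat.cast_one, one_mul]; linarith)
  refine ⟨f, (isCoAngularPreStep_iff P f).mpr (by rw [hf]), hom_ext P (N.ext (Prod.ext ?_ (Prod.ext ?_ ?_)) ?_)⟩
  · rw [comp_g, hf, PNat.one_coe, Nat.cast_one, one_smul, Datum.Ξ_one, smul_zero, add_zero]
    show (val P φ').μ.1 - (val P φ).μ.1 + (val P φ).μ.1 = (val P φ').μ.1
    abel
  · show (val P (φ ≫ f)).a = (val P φ').a
    rw [comp_a, hf, PNat.one_coe, Nat.cast_one, one_mul]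
    show (val P φ').a - (val P φ).a + (val P φ).a = (val P φ').a
    abel
  · show (val P (φ ≫ f)).b = (val P φ').b
    rw [comp_b, hf, PNat.one_coe, Nat.cast_one, one_mul]
    show (val P φ').b - (val P φ).b + (val P φ).b = (val P φ').b
    abel
  · rw [comp_d, hf, hd, hd']; rfl

/-- (iii)(d), coslice, essential surjectivity: `(0, p, q, 1) : A_n → A_{n+p+q}` has divisor `(p, q)`.
[cite: MochizukiFrdI2008, Def. 1.3(iii) p.24] -/
theorem iii_d_under_surj (A : Obj P) (x : Φ.obj (op (baseObj (toElem P) A))) :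
    ∃ (B : Obj P) (φ : A ⟶ B), IsCoAngularPreStep (toElem P) φ ∧ Div (toElem P) φ = x := by
  let pq : ℕ × ℕ := Multiplicative.toAdd x
  obtain ⟨φ, hφ⟩ := exists_hom P A ⟨A.idx + pq.1 + pq.2⟩ 0 pq.1 pq.2 1 (by positivity) (by positivity)
    (by rw [PNat.one_coe, Nat.cast_one, one_mul]; ring)
  refine ⟨_, φ, (isCoAngularPreStep_iff P φ).mpr (by rw [hφ]), ?_⟩
  rw [div_eq, hφ]
  show Multiplicative.ofAdd (((pq.1 : ℤ).toNat, (pq.2 : ℤ).toNat) : ℕ × ℕ) = x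
  rw [Int.toNat_natCast, Int.toNat_natCast]
  exact ofAdd_toAdd x

/-- `invDiv` is `Div` (identity pull-backs). [cite: MochizukiFrdI2008, Def. 1.3(iii) p.24] -/
theorem invDiv_eq {A B : Obj P} (ψ : B ⟶ A) (h : IsBaseIso (toElem P) ψ) : invDiv (toElem P) ψ h = Div (toElem P) ψ := rfl

/-- (iii)(d), slice, fullness: `Div ψ' ≤ Div ψ` lifts to `(g − g', a − a', b − b', 1) : B → B'` over `A`.
[cite: MochizukiFrdI2008, Def. 1.3(iii) p.24] -/
theorem iii_d_over_full {A B B' : Obj P} (ψ : B ⟶ A) (ψ' : B' ⟶ A) (h : IsCoAngularPreStep (toElem P) ψ)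
    (h' : IsCoAngularPreStep (toElem P) ψ')
    (hdiv : invDiv (toElem P) ψ' h'.2.2 ∣ invDiv (toElem P) ψ h.2.2) :
    ∃ g : B ⟶ B', IsCoAngularPreStep (toElem P) g ∧ g ≫ ψ' = ψ := by
  have hd : (val P ψ).d = 1 := (isCoAngularPreStep_iff P ψ).mp h
  have hd' : (val P ψ').d = 1 := (isCoAngularPreStep_iff P ψ').mp h'
  rw [invDiv_eq, invDiv_eq] at hdiv
  obtain ⟨ha, hb⟩ := le_of_div_dvd P hdiv
  have hi := idx_eq P ψ
  have hi' := idx_eq P ψ'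
  rw [hd, PNat.one_coe, Nat.cast_one, one_mul] at hi
  rw [hd', PNat.one_coe, Nat.cast_one, one_mul] at hi'
  obtain ⟨g, hg⟩ := exists_hom P B B' ((val P ψ).μ.1 - (val P ψ').μ.1) ((val P ψ).a - (val P ψ').a)
    ((val P ψ).b - (val P ψ').b) 1 (by linarith) (by linarith) (by rw [PNat.one_coe, Nat.cast_one, one_mul]; linarith)
  have hga : (val P g).a = (val P ψ).a - (val P ψ').a := by rw [hg]
  refine ⟨g, (isCoAngularPreStep_iff P g).mpr (by rw [hg]), hom_ext P (N.ext (Prod.ext ?_ (Prod.ext ?_ ?_)) ?_)⟩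
  · rw [comp_g, hd', hga, hg, PNat.one_coe, Nat.cast_one, one_smul, Datum.Ξ_one, smul_zero, add_zero]
    show (val P ψ').μ.1 + ((val P ψ).μ.1 - (val P ψ').μ.1) = (val P ψ).μ.1
    abel
  · show (val P (g ≫ ψ')).a = (val P ψ).a
    rw [comp_a, hga, hd', PNat.one_coe, Nat.cast_one, one_mul]
    abel
  · show (val P (g ≫ ψ')).b = (val P ψ).b
    rw [comp_b, hg, hd', PNat.one_coe, Nat.cast_one, one_mul]
    show (val P ψ').b + ((val P ψ).b - (val P ψ').b) = (val P ψ).b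
    abel
  · rw [comp_d, hg, hd, hd']; rfl

/-- (iii)(d), slice, essential surjectivity: `(0, p, q, 1) : A_{n−p−q} → A_n`. [cite: MochizukiFrdI2008, Def. 1.3(iii) p.24] -/
theorem iii_d_over_surj (A : Obj P) (x : Φ.obj (op (baseObj (toElem P) A))) :
    ∃ (B : Obj P) (ψ : B ⟶ A) (h : IsCoAngularPreStep (toElem P) ψ), invDiv (toElem P) ψ h.2.2 = x := by
  let pq : ℕ × ℕ := Multiplicative.toAdd x
  obtain ⟨ψ, hψ⟩ := exists_hom P ⟨A.idx - pq.1 - pq.2⟩ A 0 pq.1 pq.2 1 (by positivity) (by positivity)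
    (by rw [PNat.one_coe, Nat.cast_one, one_mul]; ring)
  refine ⟨_, ψ, (isCoAngularPreStep_iff P ψ).mpr (by rw [hψ]), ?_⟩
  rw [invDiv_eq, div_eq, hψ]
  show Multiplicative.ofAdd (((pq.1 : ℤ).toNat, (pq.2 : ℤ).toNat) : ℕ × ℕ) = x
  rw [Int.toNat_natCast, Int.toNat_natCast]
  exact ofAdd_toAdd x

end Ex46

end Literature.AlgebraicGeometry.Frobenioids
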